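import Summits.QuantumFields.YangMills.Theorems.BalabanUVNodesN06Proj349AtPinsPhysR
import Literature.MathematicalPhysics.QuantumFieldTheory.Balaban1983to89.B9WalkLettersCoordsS

/-!
# BalabanUVNodes ∕ N06 ([B9], `Dag.B9_main`) — (3.49) AT THE SITE PINS FROM THEOREM 3.7, R-GENERIC, WITH A **CLOSED CONSTANT**:
# `Proj349Maj … CP θ` for EVERY displayed `CP ≥ C_P⁽³·⁴⁹⁾ := (d+1)·c_b·b_b·N₁·(B₀·B₁′·B₀·C_g)·e^{2θ}` — v1.1 of `N06Proj349AtPinsPhysR`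

Track A of `YM-PLAN.md` (cell `pub-ymgap`, D-0062), node **N06** = [Balaban1985BackgroundPropagators] Thms 3.1–3.15; seat `pub-ymgap-dag-n06-d` (gen 15), for
dag-n06-l's OPTION-(2) table rows `hletters13` ∕ `hWE` (`ED47-REPLACEMENT-TABLE.md`; their `N06CutLettersPinsGradedAtRecord.hletters13_of_pins` p674670 and
`hWE_of_pins` p672970 take budget hypotheses `hB₃w` ∕ `hBx` whose left sides contain the (3.49) constant `C_P`).
WHY.  `N06Proj349AtPinsPhysR.proj349Maj_of_t37_display348_rateR` (this seat, edition 25's `h49`) returns `∃ M a CP, …`: its constant is ∃-BOUND, so no budget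
mentioning it can be DISPLAYED as a numeric hypothesis of the certificate (edition 57 had to run the rows-20–21 leaf at `max (Bx13 β) (BWE β)`).  But the constant the
proof builds is CLOSED in displayed data: with `B₀ := max 1 N·(m_N·p.C(exp261 geo9Y p.δ₀ p.α)·e^{2(1−2p.α)p.δ₀})` (the (3.42) constant of
`left_right342_of_t37_pairM_ofR`, `m_N` the radius-2 neighbour count), `B₁′ := c_R(basis39)·|κ39|·B₁·e^{2δ₁}` (the (3.48) constant of `blk348_of_display348_rateR`),
`N₁ := nearBlkCntY …` (dag-n06-l's member-uniform near-block count `exists_card_nearBlocks_le`, NAMED by this seat in `B9WalkLettersCoordsS` §2 with its threshold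
`walkCntM₀Y` and spec `card_nearBlocks_le`) and the displayed (3.49) threshold data `(θ, C_g, M₃)`:
`C_P⁽³·⁴⁹⁾ = (d+1)·(coordBound39 b·basisBound39 b·N₁·(B₀·B₁′·B₀·C_g)·e^{2θ})`.
WHAT (0 `def`, 0 `sorry`; kernel bookkeeping over LANDED theorems):
* `proj349Maj_mono_const` — the schema `Proj349Maj` is monotone in its constant (`hasMajorant_mono` ∕ `hasMajorantHom_mono`, `ℓ(a) > 0`).
* ★ `left_right342_of_t37_pairM_ofR_closed` — §1 of v1 with the (3.42) constant `B₀` EXPLICIT in the statement (same proof).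
* `cP349_nonneg` — `0 ≤ C_P⁽³·⁴⁹⁾`.
* ★★ `proj349Maj_of_t37_display348_rateR_ge` — v1's theorem for EVERY `CP ≥ C_P⁽³·⁴⁹⁾` (a displayed letter `CP` with ONE closed lower budget `hCPge`, the
  pattern of the certificate's `ϑF ∕ hϑF`): `∃ M a, 0 < M ∧ 0 < a ∧ ∀ x, M ≤ M_x → ∀ α₀ > 0, M_x·α₀ ≤ a → ∀ U, Reg335 → Proj349Maj … CP θ`; threshold
  `max (max M₂ M₁) (max M₃ walkCntM₀Y)`, regime `min a₀ (a₁∕c)`.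
So the next edition displays `(CP : ℝ) (hCPge : C_P⁽³·⁴⁹⁾ ≤ CP)` and every budget in `CP` (`hBxW`, later `hB₃w`) becomes a displayable numeric hypothesis.
HONEST FRAMING.  Nothing of [B9] asserted; inputs (`t37`, `h348`, `hthr`) remain HYPOTHESES of the certificate; COUNT-NEUTRAL; N06 NOT discharged; K1⁹ NOT closed;
one finite 𝕋⁴ programme at fixed `ε` — NOT continuum ∕ OS ∕ mass gap ∕ Clay.
[cite: Balaban1985BackgroundPropagators, (3.49) p.399, p.421, Thm 3.1 (3.42) p.397, Thm 3.2 (3.48) p.398, Thm 3.7 pp.409–410; Balaban1984PropagatorsII, Lemma 2.1 (2.59)–(2.61) pp.233–234, (2.51)–(2.52) p.232]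
-/

noncomputable section

namespace Summit.QuantumFields.YangMills.BalabanUVNodes.N06Proj349AtPinsPhysRC

open Literature.MathematicalPhysics.QuantumFieldTheory.Balaban1983to89
open Literature.MathematicalPhysics.QuantumFieldTheory.Balaban1983to89.Node00
open Literature.MathematicalPhysics.QuantumFieldTheory.Balaban1983to89.B6KLevelCensusIndexV1 (KIdx)
open Literature.MathematicalPhysics.QuantumFieldTheory.Balaban1983to89.B6GlobalChartV1 (blkV1)
open Literature.MathematicalPhysics.QuantumFieldTheory.Balaban1983to89.B6Ineq2142KLevelV1 (lvl β)
open Literature.MathematicalPhysics.QuantumFieldTheory.Balaban1983to89.B9Thm34Ext (toB6)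
open Literature.MathematicalPhysics.QuantumFieldTheory.Balaban1983to89.B9Thm37Whole (Ops Conv342)
open Literature.MathematicalPhysics.QuantumFieldTheory.Balaban1983to89.B9Cor38Whole (WalkReading)
open Literature.MathematicalPhysics.QuantumFieldTheory.Balaban1983to89.B9Thm39WholeBlk (Conv348Blk)
open Literature.MathematicalPhysics.QuantumFieldTheory.Balaban1983to89.B9Thm39OneCubeReadingAtLettersY (oneCubeOps39YF)
open Literature.MathematicalPhysics.QuantumFieldTheory.Balaban1983to89.B9Thm39ReadingAtLetters (basis39 κ39)
open Literature.MathematicalPhysics.QuantumFieldTheory.Balaban1983to89.B9Thm39ReadingCoords (cR39)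
open Literature.MathematicalPhysics.QuantumFieldTheory.Balaban1983to89.B9CoReadingCoords (blkBK)
open Literature.MathematicalPhysics.QuantumFieldTheory.Balaban1983to89.B9CoReadingCoordsS (XSK blkSK sIK GcoS DcoS)
open Literature.MathematicalPhysics.QuantumFieldTheory.Balaban1983to89.B9Ineq349SiteReading (fineEntryS)
open Literature.MathematicalPhysics.QuantumFieldTheory.Balaban1983to89.B9Ineq349SiteComposite (lenB distB lenB_pos Left342At Right342At Blk348At)
open Literature.MathematicalPhysics.QuantumFieldTheory.Balaban1983to89.B9Ineq349SiteFromBlocks (geo9Y_M_eq)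
open Literature.MathematicalPhysics.QuantumFieldTheory.Balaban1983to89.B9Ineq349SiteFromConv342 (left342At_of_hasMajorants contractive_of_mem)
open Literature.MathematicalPhysics.QuantumFieldTheory.Balaban1983to89.B9Ineq349SiteFromConv348 (blk348At_of_hasMajorant)
open Literature.MathematicalPhysics.QuantumFieldTheory.Balaban1983to89.B9Ineq349SiteAdjoint (right342At_of_left342At isSymmTr_GpY_parSymY)
open Literature.MathematicalPhysics.QuantumFieldTheory.Balaban1983to89.B9Thm311ReadingCoords (IsSymmTr)
open Literature.MathematicalPhysics.QuantumFieldTheory.Balaban1983to89.B9RWSumsDefinitePins (PinPrims)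
open Literature.MathematicalPhysics.QuantumFieldTheory.Balaban1983to89.B9RWSumsDefinitePinsPair (PairPrims)
open Literature.MathematicalPhysics.QuantumFieldTheory.Balaban1983to89.B9RWSumsDefinitePinsPairM (MixedPrims E37YPairM)
open Literature.MathematicalPhysics.QuantumFieldTheory.Balaban1983to89.B9RWSums347DefiniteFaces (exp261)
open Literature.MathematicalPhysics.QuantumFieldTheory.Balaban1983to89.B7Prop2SpecialUnitary (specialUnitaryUnits specialUnitaryUnits_le_unitaryUnits)
open Literature.MathematicalPhysics.QuantumFieldTheory.Balaban1983to89.B9PinMembersKLevelV1 (MemberY geo9Y bg9Y)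
open Literature.MathematicalPhysics.QuantumFieldTheory.Balaban1983to89.B9BackgroundsKLevelV1R (RegFamY bg9YR MemOfFam mem_of_reg335R)
open Literature.MathematicalPhysics.QuantumFieldTheory.Balaban1983to89.B9RWSumsReadsNbr (nbr)
open Literature.MathematicalPhysics.QuantumFieldTheory.Balaban1983to89.B9PerturbationMajorantAlgebra (Proj349Maj)
open Literature.MathematicalPhysics.QuantumFieldTheory.Balaban1983to89.B9PerturbationMajorantsAtLetters (PcoK)
open Literature.MathematicalPhysics.QuantumFieldTheory.Balaban1983to89.Node00.OpsYSectDCoords (DvcoKH DvscoKH)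
open Literature.MathematicalPhysics.QuantumFieldTheory.Balaban1983to89.B9Proj349MajFromBlocks (proj349Maj_of_allBlocks)
open Literature.MathematicalPhysics.QuantumFieldTheory.Balaban1983to89.B9SitePinBlockCounts (exists_card_nearBlocks_le)
open scoped Matrix.Norms.L2Operator
open Summit.QuantumFields.YangMills.BalabanUVNodes.N06Proj349AtPinsPhysR (blk348_of_display348_rateR)
open Literature.MathematicalPhysics.QuantumFieldTheory.Balaban1983to89.B9WalkLettersCoordsS (nearBlkCntY walkCntM₀Y nearBlkCntY_nonneg card_nearBlocks_le)
open Literature.MathematicalPhysics.QuantumFieldTheory.Balaban1983to89.B9Thm39ReadingCoords (coordBound39 basisBound39)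
open Literature.MathematicalPhysics.QuantumFieldTheory.Balaban1983to89.B6RandomWalk (hasMajorant_mono)
open Literature.MathematicalPhysics.QuantumFieldTheory.Balaban1983to89.B6RandomWalkHom (hasMajorantHom_mono)
open Literature.MathematicalPhysics.QuantumFieldTheory.Balaban1983to89.B9GeoLemma21KLevelV1 (geo9Y_len_pos)

variable {N : ℕ} {κ : Type} [Fintype κ] [DecidableEq κ]

/-! ## §0 The schema is monotone in its constant -/

/-- `Proj349Maj … CP δP → CP ≤ CP′ → Proj349Maj … CP′ δP` at def-Y's members (`ℓ(a) > 0`). [cite: Balaban1985BackgroundPropagators, (3.49) p.399; Balaban1984PropagatorsII, (2.51) p.232, bookkeeping] -/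
theorem proj349Maj_mono_const {d ℓ : ℕ} {hd : 1 ≤ d + 1} {hL : Odd (ℓ + 1) ∧ 1 < ℓ + 1} {b₀ b₁ : ℝ} {Mstar : ℕ} (x : MemberY d ℓ hd hL b₀ b₁ Mstar)
    [Fintype (geo9Y x).Site] {XS XB : Type} [Fintype XS] [Fintype XB] {blkW : XS → (geo9Y x).Site} {blk : XB → (geo9Y x).Site}
    {P : Module.End ℝ (XS → ℝ)} {Dv : (XS → ℝ) →ₗ[ℝ] (XB → ℝ)} {Dvs : (XB → ℝ) →ₗ[ℝ] (XS → ℝ)} {R₀ : ℝ} {H₀ : Prop} {CP CP' δP : ℝ}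
    (h : Proj349Maj (g := geo9Y x) blkW blk P Dv Dvs R₀ H₀ CP δP) (hle : CP ≤ CP') : Proj349Maj (g := geo9Y x) blkW blk P Dv Dvs R₀ H₀ CP' δP :=
  ⟨hasMajorant_mono _ h.p0 fun _ _ => mul_le_mul_of_nonneg_right hle (Real.exp_nonneg _),
    hasMajorantHom_mono _ _ h.p1 fun a _ => mul_le_mul_of_nonneg_right (mul_le_mul_of_nonneg_right hle (inv_nonneg.2 (geo9Y_len_pos x a).le)) (Real.exp_nonneg _),
    hasMajorantHom_mono _ _ h.p2 fun a _ => mul_le_mul_of_nonneg_right (mul_le_mul_of_nonneg_right hle (inv_nonneg.2 (geo9Y_len_pos x a).le)) (Real.exp_nonneg _)⟩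

/-! ## §1 Row 25's (3.42) input with its constant explicit -/

/-- ★ **THE (3.42) INPUTS OF (3.49) AT THE RATE OF THE PINS, CONSTANT EXPLICIT** — v1's `left_right342_of_t37_pairM_ofR` with its constant
`B₀ = max 1 N·(m_N·p.C(exp261 geo9Y p.δ₀ p.α)·e^{2(1−2p.α)p.δ₀})` written in the statement (same proof: n06-i's `left342At_of_hasMajorants`,
`right342At_of_left342At`, `B, N·B ≤ max 1 N·B`). [cite: Balaban1985BackgroundPropagators, Thm 3.1 (3.42) p.397 ⇐ Thm 3.7 pp.409–410; (3.25) p.394, (3.35) p.396; (3.49) p.399] -/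
theorem left_right342_of_t37_pairM_ofR_closed (θ : Stage3Params) (Mstar : ℕ) {R₁ R₂ : RegFamY θ.d₆ θ.ℓ₆ θ.hd' θ.hL' θ.b₀ θ.b₁ Mstar (Matrix (Fin N) (Fin N) ℂ)}
    (hG : MemOfFam (specialUnitaryUnits (Fin N)) R₁) (𝔏 : LettersY N θ Mstar)
    (hparS : ∀ x : MemberY θ.d₆ θ.ℓ₆ θ.hd' θ.hL' θ.b₀ θ.b₁ Mstar, (𝔏 x).parS = parSymY x.toKIdx)
    (hGp : ∀ x : MemberY θ.d₆ θ.ℓ₆ θ.hd' θ.hL' θ.b₀ θ.b₁ Mstar, (𝔏 x).Gp = GpY x.toKIdx (parSymY x.toKIdx))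
    [∀ x : MemberY θ.d₆ θ.ℓ₆ θ.hd' θ.hL' θ.b₀ θ.b₁ Mstar, Fintype (geo9Y x).Site] [∀ x : MemberY θ.d₆ θ.ℓ₆ θ.hd' θ.hL' θ.b₀ θ.b₁ Mstar, DecidableEq (geo9Y x).Site]
    (b : Module.Basis κ ℝ (Matrix (Fin N) (Fin N) ℂ)) {c35 : ℝ}
    {bI : ∀ x : MemberY θ.d₆ θ.ℓ₆ θ.hd' θ.hL' θ.b₀ θ.b₁ Mstar, FBondY x.toKIdx → IBondY x.toKIdx}
    (hlev : ∀ (x : MemberY θ.d₆ θ.ℓ₆ θ.hd' θ.hL' θ.b₀ θ.b₁ Mstar) (f : FBondY x.toKIdx), lvl x.hN x.D x.hk (bI x f) = (blkV1 x.hN x.D f).1.1)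
    (hβ1 : ∀ (x : MemberY θ.d₆ θ.ℓ₆ θ.hd' θ.hL' θ.b₀ θ.b₁ Mstar) (f : FBondY x.toKIdx),
      (B6Geom246MultiLevelTorus.geomT x.D).dist (β x.hN x.D x.hk (bI x f)) (blkV1 x.hN x.D f) ≤ 1)
    {mN : ℕ} (hnbr : ∀ (x : MemberY θ.d₆ θ.ℓ₆ θ.hd' θ.hL' θ.b₀ θ.b₁ Mstar) (y : (geo9Y x).Site), (nbr (geo9Y x) 2 y).card ≤ mN)
    {ι : MemberY θ.d₆ θ.ℓ₆ θ.hd' θ.hL' θ.b₀ θ.b₁ Mstar → Type}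
    (𝔬 : ∀ x : MemberY θ.d₆ θ.ℓ₆ θ.hd' θ.hL' θ.b₀ θ.b₁ Mstar, Ops (geo9Y x) (bg9YR (Matrix (Fin N) (Fin N) ℂ) (specialUnitaryUnits (Fin N)) R₁ R₂ x)
      (XSK κ x.toKIdx) (XSK κ x.toKIdx) (ι x))
    (rd : ∀ x : MemberY θ.d₆ θ.ℓ₆ θ.hd' θ.hL' θ.b₀ θ.b₁ Mstar, WalkReading (geo9Y x) (bg9YR (Matrix (Fin N) (Fin N) ℂ) (specialUnitaryUnits (Fin N)) R₁ R₂ x)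
      (XSK κ x.toKIdx) (ι x))
    (H : MemberY θ.d₆ θ.ℓ₆ θ.hd' θ.hL' θ.b₀ θ.b₁ Mstar → Prop) {m mN' : ℕ} {Cev NQ : ℝ} {p q : PinPrims} (hp : p.OK) {p3 q3 : PairPrims}
    {pM qM : MixedPrims}
    {K : ∀ x : MemberY θ.d₆ θ.ℓ₆ θ.hd' θ.hL' θ.b₀ θ.b₁ Mstar, B9.KernelFamily (geo9Y x) (bg9YR (Matrix (Fin N) (Fin N) ℂ) (specialUnitaryUnits (Fin N)) R₁ R₂ x)}
    (t37 : B9.Thm37Printed c35 (fun x : MemberY θ.d₆ θ.ℓ₆ θ.hd' θ.hL' θ.b₀ θ.b₁ Mstar => geo9Y x)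
      (bg9YR (Matrix (Fin N) (Fin N) ℂ) (specialUnitaryUnits (Fin N)) R₁ R₂)
      (fun x => E37YPairM (bg := bg9YR (Matrix (Fin N) (Fin N) ℂ) (specialUnitaryUnits (Fin N)) R₁ R₂) m mN' Cev NQ p q p3 q3 pM qM (𝔬 x) (rd x) (H x) (K x)))
    (hblkS : ∀ x : MemberY θ.d₆ θ.ℓ₆ θ.hd' θ.hL' θ.b₀ θ.b₁ Mstar, (𝔬 x).blk = blkSK x.toKIdx (sIK x.toKIdx (bI x)))
    (hblkYS : ∀ x : MemberY θ.d₆ θ.ℓ₆ θ.hd' θ.hL' θ.b₀ θ.b₁ Mstar, (𝔬 x).blkY = blkSK x.toKIdx (sIK x.toKIdx (bI x)))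
    (hGpS : ∀ (x : MemberY θ.d₆ θ.ℓ₆ θ.hd' θ.hL' θ.b₀ θ.b₁ Mstar) (U : (bg9YR (Matrix (Fin N) (Fin N) ℂ) (specialUnitaryUnits (Fin N)) R₁ R₂ x).Cfg),
      (𝔬 x).Gp U = GcoS x.toKIdx b (bg9YR (Matrix (Fin N) (Fin N) ℂ) (specialUnitaryUnits (Fin N)) R₁ R₂ x) (fun U => U) (𝔏 x).Gp U)
    (hDS : ∀ (x : MemberY θ.d₆ θ.ℓ₆ θ.hd' θ.hL' θ.b₀ θ.b₁ Mstar) (U : (bg9YR (Matrix (Fin N) (Fin N) ℂ) (specialUnitaryUnits (Fin N)) R₁ R₂ x).Cfg),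
      (𝔬 x).D U = DcoS x.toKIdx b (bg9YR (Matrix (Fin N) (Fin N) ℂ) (specialUnitaryUnits (Fin N)) R₁ R₂ x) (fun U => U) U) :
    ∃ M₁ a₀ : ℝ, 0 < M₁ ∧ 0 < a₀ ∧
      ∀ x : MemberY θ.d₆ θ.ℓ₆ θ.hd' θ.hL' θ.b₀ θ.b₁ Mstar, M₁ ≤ (geo9Y x).M → ∀ α₀ : ℝ, 0 < α₀ → (geo9Y x).M * α₀ ≤ a₀ →
        ∀ U : (bg9YR (Matrix (Fin N) (Fin N) ℂ) (specialUnitaryUnits (Fin N)) R₁ R₂ x).Cfg,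
          (bg9YR (Matrix (Fin N) (Fin N) ℂ) (specialUnitaryUnits (Fin N)) R₁ R₂ x).Reg335 c35 α₀ U →
          Left342At x.toKIdx (𝔏 x).parS (𝔏 x).Gp U
              (max 1 (N : ℝ) * ((mN : ℝ) * p.C (exp261 (@geo9Y θ.d₆ θ.ℓ₆ θ.hd' θ.hL' θ.b₀ θ.b₁ Mstar) p.δ₀ p.α) * Real.exp (2 * ((1 - 2 * p.α) * p.δ₀)))) ((1 - 2 * p.α) * p.δ₀) ∧
            Right342At x.toKIdx (𝔏 x).parS (𝔏 x).Gp U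
              (max 1 (N : ℝ) * ((mN : ℝ) * p.C (exp261 (@geo9Y θ.d₆ θ.ℓ₆ θ.hd' θ.hL' θ.b₀ θ.b₁ Mstar) p.δ₀ p.α) * Real.exp (2 * ((1 - 2 * p.α) * p.δ₀)))) ((1 - 2 * p.α) * p.δ₀) := by
  obtain ⟨M₂, a₀, hM₂, ha₀, H37⟩ := t37
  set C : ℝ := p.C (exp261 (@geo9Y θ.d₆ θ.ℓ₆ θ.hd' θ.hL' θ.b₀ θ.b₁ Mstar) p.δ₀ p.α) with hCdef
  set δ : ℝ := (1 - 2 * p.α) * p.δ₀ with hδdef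
  have hC : 0 ≤ C := p.C_nonneg hp _
  have hδ : 0 < δ := PinPrims.rate_pos hp
  have hB0 : 0 ≤ (mN : ℝ) * C * Real.exp (2 * δ) := by positivity
  refine ⟨M₂, a₀, hM₂, ha₀, fun x hM α₀ hα₀ hMa U hU => ?_⟩
  -- row 18's leaf: the first conjunct of the `PairM` E-letter's convergence predicate at the site pins
  obtain ⟨h0, h1, -, -⟩ := (show Conv342 (𝔬 x) 1 (H x) C δ U from (H37 x hM α₀ hα₀ hMa U hU).1)
  rw [hblkS x, hGpS x U] at h0
  rw [hblkS x, hblkYS x, hGpS x U, hDS x U] at h1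
  have hUG : ∀ μ y, U μ y ∈ specialUnitaryUnits (Fin N) := mem_of_reg335R hG x hU
  have hUu : ∀ μ y, (U μ y : Matrix (Fin N) (Fin N) ℂ) ∈ unitary (Matrix (Fin N) (Fin N) ℂ) :=
    fun μ y => specialUnitaryUnits_le_unitaryUnits (hUG μ y)
  have hpar : ∀ z w : SiteY x.toKIdx, ‖((𝔏 x).parS U z w : Matrix (Fin N) (Fin N) ℂ)‖ ≤ 1 ∧
      ‖((((𝔏 x).parS U z w)⁻¹ : (Matrix (Fin N) (Fin N) ℂ)ˣ) : Matrix (Fin N) (Fin N) ℂ)‖ ≤ 1 := fun z w =>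
    contractive_of_mem specialUnitaryUnits_le_unitaryUnits (by rw [hparS x]; exact parSymY_mem x.toKIdx hUG z w)
  have hparu : ∀ (s : BlkY x.toKIdx) (z : SiteY x.toKIdx),
      ((𝔏 x).parS U (blkCornerY x.toKIdx s) z : Matrix (Fin N) (Fin N) ℂ) ∈ unitary (Matrix (Fin N) (Fin N) ℂ) := fun s z =>
    specialUnitaryUnits_le_unitaryUnits (by rw [hparS x]; exact parSymY_mem x.toKIdx hUG _ z)
  have hsymm : IsSymmTr (fun _ => (1 : ℝ)) ((𝔏 x).Gp U) := by
    rw [hGp x]; exact isSymmTr_GpY_parSymY x.toKIdx specialUnitaryUnits_le_unitaryUnits hUG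
  have hLe := left342At_of_hasMajorants (κ := κ) x b (B := bg9YR (Matrix (Fin N) (Fin N) ℂ) (specialUnitaryUnits (Fin N)) R₁ R₂ x) (fun U => U)
    (𝔏 x).Gp (𝔏 x).parS U (hlev x) (hβ1 x) (hnbr x) hpar hC hδ.le h0 h1
  have hRi := right342At_of_left342At x.toKIdx hUu hparu hsymm hB0 hLe
  -- both schemas are monotone in the constant: `B, N·B ≤ max 1 N · B`
  have hle₁ : (mN : ℝ) * C * Real.exp (2 * δ) ≤ max 1 (N : ℝ) * ((mN : ℝ) * C * Real.exp (2 * δ)) := by nlinarith [le_max_left (1 : ℝ) N]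
  have hle₂ : (N : ℝ) * ((mN : ℝ) * C * Real.exp (2 * δ)) ≤ max 1 (N : ℝ) * ((mN : ℝ) * C * Real.exp (2 * δ)) :=
    mul_le_mul_of_nonneg_right (le_max_right _ _) hB0
  refine ⟨fun s s₁ F hF z hz => ⟨?_, fun μ => ?_⟩, fun s₂ s' x' hx' E hE => ⟨?_, fun ν => ?_⟩⟩
  · exact (hLe s s₁ F hF z hz).1.trans (by
      have := (lenB_pos x.toKIdx s).le
      exact mul_le_mul_of_nonneg_right (mul_le_mul_of_nonneg_right hle₁ (pow_nonneg this 2)) (Real.exp_nonneg _))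
  · exact ((hLe s s₁ F hF z hz).2 μ).trans (by
      have := (lenB_pos x.toKIdx s).le
      exact mul_le_mul_of_nonneg_right (mul_le_mul_of_nonneg_right hle₁ this) (Real.exp_nonneg _))
  · exact (hRi s₂ s' x' hx' E hE).1.trans (by
      have := (lenB_pos x.toKIdx s').le
      exact mul_le_mul_of_nonneg_right (mul_le_mul_of_nonneg_right hle₂ (pow_nonneg this 2)) (Real.exp_nonneg _))
  · exact ((hRi s₂ s' x' hx' E hE).2 ν).trans (by
      have := (lenB_pos x.toKIdx s').le
      exact mul_le_mul_of_nonneg_right (mul_le_mul_of_nonneg_right hle₂ this) (Real.exp_nonneg _))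

/-! ## §2 ★★ The (3.49) majorant schema at an explicit rate, for every displayed constant above the closed one -/

omit [DecidableEq κ] in
/-- `0 ≤ C_P⁽³·⁴⁹⁾` (the closed (3.49) constant; for the certificate's `hCP := (cP349_nonneg …).trans hCPge`). [cite: Balaban1985BackgroundPropagators, (3.49) p.399, bookkeeping] -/
theorem cP349_nonneg (θ : Stage3Params) (Mstar : ℕ) [∀ x : MemberY θ.d₆ θ.ℓ₆ θ.hd' θ.hL' θ.b₀ θ.b₁ Mstar, Fintype (geo9Y x).Site]
    (b : Module.Basis κ ℝ (Matrix (Fin N) (Fin N) ℂ)) (mN : ℕ) {p : PinPrims} (hp : p.OK) {B₁ : ℝ} (hB : 0 ≤ B₁)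
    (δ₁ θ₉ : ℝ) {Cg : ℝ} (hCg : 0 ≤ Cg) :
    0 ≤ ((θ.d₆ + 1 : ℕ) : ℝ) * (coordBound39 b * basisBound39 b * nearBlkCntY θ.d₆ θ.ℓ₆ θ.hd' θ.hL' θ.b₀ θ.b₁ Mstar *
        ((max 1 (N : ℝ) * ((mN : ℝ) * p.C (exp261 (@geo9Y θ.d₆ θ.ℓ₆ θ.hd' θ.hL' θ.b₀ θ.b₁ Mstar) p.δ₀ p.α) * Real.exp (2 * ((1 - 2 * p.α) * p.δ₀)))) *
          (cR39 (basis39 (Matrix (Fin N) (Fin N) ℂ)) * Fintype.card (κ39 (Matrix (Fin N) (Fin N) ℂ)) * B₁ * Real.exp (2 * δ₁)) *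
          (max 1 (N : ℝ) * ((mN : ℝ) * p.C (exp261 (@geo9Y θ.d₆ θ.ℓ₆ θ.hd' θ.hL' θ.b₀ θ.b₁ Mstar) p.δ₀ p.α) * Real.exp (2 * ((1 - 2 * p.α) * p.δ₀)))) * Cg) * Real.exp (2 * θ₉)) := by
  have := p.C_nonneg hp (exp261 (@geo9Y θ.d₆ θ.ℓ₆ θ.hd' θ.hL' θ.b₀ θ.b₁ Mstar) p.δ₀ p.α)
  have hcb' : 0 ≤ coordBound39 b := norm_nonneg _
  have hbb' : 0 ≤ basisBound39 b := Finset.sum_nonneg fun _ _ => norm_nonneg _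
  have hN₁0 : 0 ≤ nearBlkCntY θ.d₆ θ.ℓ₆ θ.hd' θ.hL' θ.b₀ θ.b₁ Mstar := nearBlkCntY_nonneg
  have hcR : 0 ≤ cR39 (basis39 (Matrix (Fin N) (Fin N) ℂ)) := B9Thm39ReadingCoords.cR39_nonneg _
  positivity

/-- ★★ **`Proj349Maj` — THE CERTIFICATE's `h49` — AT def-Y's MEMBERS WITH ITS RATE `θ` EXPOSED, FOR EVERY DISPLAYED CONSTANT `CP ≥ C_P⁽³·⁴⁹⁾`** — v1's
`proj349Maj_of_t37_display348_rateR` (inputs verbatim: `𝔏` with the standard `parS ∕ Gp`, row 18's leaf `t37` on the `PairM` E-letter, rows 15–16's display `h348`,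
the block map `bI`, the radius-2 count `hnbr`, the (3.49) threshold fact `hthr` at the rate `θ`) PLUS the letter `CP` with the closed budget `hCPge : C_P⁽³·⁴⁹⁾ ≤ CP`;
output `∃ M a, …, Proj349Maj … CP θ` (no ∃-constant): §1, v1's `blk348_of_display348_rateR`, dag-n06-l's `proj349Maj_of_allBlocks` at the NAMED near-block count
(`card_nearBlocks_le` above `walkCntM₀Y`), and §0's monotonicity. [cite: Balaban1985BackgroundPropagators, (3.49) p.399 («using again Lemma 2.1»), p.421, Thm 3.1 (3.42) p.397, Thm 3.2 (3.48) p.398; Balaban1984PropagatorsII, Lemma 2.1 (2.59)–(2.61) pp.233–234, (2.51)–(2.52) p.232] -/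
theorem proj349Maj_of_t37_display348_rateR_ge (θ : Stage3Params) (Mstar : ℕ) {R₁ R₂ : RegFamY θ.d₆ θ.ℓ₆ θ.hd' θ.hL' θ.b₀ θ.b₁ Mstar (Matrix (Fin N) (Fin N) ℂ)}
    (hG : MemOfFam (specialUnitaryUnits (Fin N)) R₁) (𝔏 : LettersY N θ Mstar)
    (hparS : ∀ x : MemberY θ.d₆ θ.ℓ₆ θ.hd' θ.hL' θ.b₀ θ.b₁ Mstar, (𝔏 x).parS = parSymY x.toKIdx)
    (hGp : ∀ x : MemberY θ.d₆ θ.ℓ₆ θ.hd' θ.hL' θ.b₀ θ.b₁ Mstar, (𝔏 x).Gp = GpY x.toKIdx (parSymY x.toKIdx))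
    [∀ x : MemberY θ.d₆ θ.ℓ₆ θ.hd' θ.hL' θ.b₀ θ.b₁ Mstar, Fintype (geo9Y x).Site] [∀ x : MemberY θ.d₆ θ.ℓ₆ θ.hd' θ.hL' θ.b₀ θ.b₁ Mstar, DecidableEq (geo9Y x).Site]
    (b : Module.Basis κ ℝ (Matrix (Fin N) (Fin N) ℂ)) (hcb : 0 < cR39 b) {c35 : ℝ} (hc : 0 < c35)
    {bI : ∀ x : MemberY θ.d₆ θ.ℓ₆ θ.hd' θ.hL' θ.b₀ θ.b₁ Mstar, FBondY x.toKIdx → IBondY x.toKIdx}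
    (hbI0 : ∀ (x : MemberY θ.d₆ θ.ℓ₆ θ.hd' θ.hL' θ.b₀ θ.b₁ Mstar) (f : FBondY x.toKIdx), bI x f = bI x ⟨f.src, 0⟩)
    (hlev : ∀ (x : MemberY θ.d₆ θ.ℓ₆ θ.hd' θ.hL' θ.b₀ θ.b₁ Mstar) (f : FBondY x.toKIdx), lvl x.hN x.D x.hk (bI x f) = (blkV1 x.hN x.D f).1.1)
    (hβ1 : ∀ (x : MemberY θ.d₆ θ.ℓ₆ θ.hd' θ.hL' θ.b₀ θ.b₁ Mstar) (f : FBondY x.toKIdx),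
      (B6Geom246MultiLevelTorus.geomT x.D).dist (β x.hN x.D x.hk (bI x f)) (blkV1 x.hN x.D f) ≤ 1)
    {mN : ℕ} (hnbr : ∀ (x : MemberY θ.d₆ θ.ℓ₆ θ.hd' θ.hL' θ.b₀ θ.b₁ Mstar) (y : (geo9Y x).Site), (nbr (geo9Y x) 2 y).card ≤ mN)
    -- row 18: Theorem 3.7's leaf on the `PairM` E-letter at the site pins
    {ι : MemberY θ.d₆ θ.ℓ₆ θ.hd' θ.hL' θ.b₀ θ.b₁ Mstar → Type}
    (𝔬 : ∀ x : MemberY θ.d₆ θ.ℓ₆ θ.hd' θ.hL' θ.b₀ θ.b₁ Mstar, Ops (geo9Y x) (bg9YR (Matrix (Fin N) (Fin N) ℂ) (specialUnitaryUnits (Fin N)) R₁ R₂ x)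
      (XSK κ x.toKIdx) (XSK κ x.toKIdx) (ι x))
    (rd : ∀ x : MemberY θ.d₆ θ.ℓ₆ θ.hd' θ.hL' θ.b₀ θ.b₁ Mstar, WalkReading (geo9Y x) (bg9YR (Matrix (Fin N) (Fin N) ℂ) (specialUnitaryUnits (Fin N)) R₁ R₂ x)
      (XSK κ x.toKIdx) (ι x))
    (H : MemberY θ.d₆ θ.ℓ₆ θ.hd' θ.hL' θ.b₀ θ.b₁ Mstar → Prop) {m mN' : ℕ} {Cev NQ : ℝ} {p q : PinPrims} (hp : p.OK) {p3 q3 : PairPrims}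
    {pM qM : MixedPrims}
    {K : ∀ x : MemberY θ.d₆ θ.ℓ₆ θ.hd' θ.hL' θ.b₀ θ.b₁ Mstar, B9.KernelFamily (geo9Y x) (bg9YR (Matrix (Fin N) (Fin N) ℂ) (specialUnitaryUnits (Fin N)) R₁ R₂ x)}
    (t37 : B9.Thm37Printed c35 (fun x : MemberY θ.d₆ θ.ℓ₆ θ.hd' θ.hL' θ.b₀ θ.b₁ Mstar => geo9Y x)
      (bg9YR (Matrix (Fin N) (Fin N) ℂ) (specialUnitaryUnits (Fin N)) R₁ R₂)
      (fun x => E37YPairM (bg := bg9YR (Matrix (Fin N) (Fin N) ℂ) (specialUnitaryUnits (Fin N)) R₁ R₂) m mN' Cev NQ p q p3 q3 pM qM (𝔬 x) (rd x) (H x) (K x)))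
    (hblkS : ∀ x : MemberY θ.d₆ θ.ℓ₆ θ.hd' θ.hL' θ.b₀ θ.b₁ Mstar, (𝔬 x).blk = blkSK x.toKIdx (sIK x.toKIdx (bI x)))
    (hblkYS : ∀ x : MemberY θ.d₆ θ.ℓ₆ θ.hd' θ.hL' θ.b₀ θ.b₁ Mstar, (𝔬 x).blkY = blkSK x.toKIdx (sIK x.toKIdx (bI x)))
    (hGpS : ∀ (x : MemberY θ.d₆ θ.ℓ₆ θ.hd' θ.hL' θ.b₀ θ.b₁ Mstar) (U : (bg9YR (Matrix (Fin N) (Fin N) ℂ) (specialUnitaryUnits (Fin N)) R₁ R₂ x).Cfg),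
      (𝔬 x).Gp U = GcoS x.toKIdx b (bg9YR (Matrix (Fin N) (Fin N) ℂ) (specialUnitaryUnits (Fin N)) R₁ R₂ x) (fun U => U) (𝔏 x).Gp U)
    (hDS : ∀ (x : MemberY θ.d₆ θ.ℓ₆ θ.hd' θ.hL' θ.b₀ θ.b₁ Mstar) (U : (bg9YR (Matrix (Fin N) (Fin N) ℂ) (specialUnitaryUnits (Fin N)) R₁ R₂ x).Cfg),
      (𝔬 x).D U = DcoS x.toKIdx b (bg9YR (Matrix (Fin N) (Fin N) ℂ) (specialUnitaryUnits (Fin N)) R₁ R₂ x) (fun U => U) U)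
    -- rows 15–16: the one display `(3.48)⁻¹` on the faithful one-cube letters over `𝔏`
    {B₁ δ₁ a₁ M₁ : ℝ} (hB : 0 ≤ B₁) (hδ : 0 < δ₁) (ha₁ : 0 < a₁)
    (h348 : ∀ x : MemberY θ.d₆ θ.ℓ₆ θ.hd' θ.hL' θ.b₀ θ.b₁ Mstar, M₁ ≤ (geo9Y x).M → ∀ α₀ : ℝ, 0 < α₀ → c35 * (geo9Y x).M * α₀ ≤ a₁ →
      ∀ U : (bg9YR (Matrix (Fin N) (Fin N) ℂ) (specialUnitaryUnits (Fin N)) R₁ R₂ x).Cfg,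
        (bg9YR (Matrix (Fin N) (Fin N) ℂ) (specialUnitaryUnits (Fin N)) R₁ R₂ x).Reg335 c35 α₀ U → Conv348Blk (oneCubeOps39YF θ Mstar 𝔏 bI x) B₁ δ₁ U)
    -- the (3.49) threshold fact AT THE RATE θ for the rate pair ((1−2α)δ₀, δ₁)
    (θ₉ Cg M₃ : ℝ) (hθ₉ : 0 ≤ θ₉) (hCg : 0 ≤ Cg)
    (hthr : ∀ i : KIdx θ.d₆ θ.ℓ₆ θ.hd' θ.hL' θ.b₀ θ.b₁, M₃ ≤ ((θ.ℓ₆ : ℝ) + 1) * i.Mh →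
      ∀ (parS : SiteParY (Matrix (Fin N) (Fin N) ℂ) i) (Gp : SiteOpY (Matrix (Fin N) (Fin N) ℂ) i) (U : CfgY (Matrix (Fin N) (Fin N) ℂ) i) (B₀ B₁' : ℝ),
        0 ≤ B₀ → 0 ≤ B₁' → Left342At i parS Gp U B₀ ((1 - 2 * p.α) * p.δ₀) → Right342At i parS Gp U B₀ ((1 - 2 * p.α) * p.δ₀) →
        Blk348At i parS Gp U B₁' δ₁ →
          ∀ (n : Fin 4) (s s' : BlkY i), fineEntryS i (P349Y i parS Gp) U s s' n ≤
            B₀ * B₁' * B₀ * Cg * B9.pref4inv (lenB i s) n * lenB i s' ^ (-((θ.d₆ + 1 : ℕ) : ℝ)) * Real.exp (-(θ₉ * distB i s s')))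
    -- the DISPLAYED constant letter with its one closed lower budget
    (CP : ℝ) (hCPge : ((θ.d₆ + 1 : ℕ) : ℝ) * (coordBound39 b * basisBound39 b * nearBlkCntY θ.d₆ θ.ℓ₆ θ.hd' θ.hL' θ.b₀ θ.b₁ Mstar *
        ((max 1 (N : ℝ) * ((mN : ℝ) * p.C (exp261 (@geo9Y θ.d₆ θ.ℓ₆ θ.hd' θ.hL' θ.b₀ θ.b₁ Mstar) p.δ₀ p.α) * Real.exp (2 * ((1 - 2 * p.α) * p.δ₀)))) *
          (cR39 (basis39 (Matrix (Fin N) (Fin N) ℂ)) * Fintype.card (κ39 (Matrix (Fin N) (Fin N) ℂ)) * B₁ * Real.exp (2 * δ₁)) *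
          (max 1 (N : ℝ) * ((mN : ℝ) * p.C (exp261 (@geo9Y θ.d₆ θ.ℓ₆ θ.hd' θ.hL' θ.b₀ θ.b₁ Mstar) p.δ₀ p.α) * Real.exp (2 * ((1 - 2 * p.α) * p.δ₀)))) * Cg) * Real.exp (2 * θ₉)) ≤ CP) :
    ∃ M a : ℝ, 0 < M ∧ 0 < a ∧
      ∀ x : MemberY θ.d₆ θ.ℓ₆ θ.hd' θ.hL' θ.b₀ θ.b₁ Mstar, M ≤ (geo9Y x).M → ∀ α₀ : ℝ, 0 < α₀ → (geo9Y x).M * α₀ ≤ a →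
        ∀ U : (bg9YR (Matrix (Fin N) (Fin N) ℂ) (specialUnitaryUnits (Fin N)) R₁ R₂ x).Cfg,
          (bg9YR (Matrix (Fin N) (Fin N) ℂ) (specialUnitaryUnits (Fin N)) R₁ R₂ x).Reg335 c35 α₀ U →
          Proj349Maj (g := geo9Y x) (blkSK x.toKIdx (sIK x.toKIdx (bI x))) (blkBK x.toKIdx (bI x))
            (PcoK x.toKIdx b (bg9YR (Matrix (Fin N) (Fin N) ℂ) (specialUnitaryUnits (Fin N)) R₁ R₂ x) (fun U => U) (𝔏 x).parS (𝔏 x).Gp U)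
            (DvcoKH x.toKIdx b (bg9YR (Matrix (Fin N) (Fin N) ℂ) (specialUnitaryUnits (Fin N)) R₁ R₂ x) (fun U => U) U)
            (DvscoKH x.toKIdx b (bg9YR (Matrix (Fin N) (Fin N) ℂ) (specialUnitaryUnits (Fin N)) R₁ R₂ x) (fun U => U) U) 1 (H x) CP θ₉ := by
  obtain ⟨M₂, a₀, hM₂, ha₀, h342⟩ :=
    left_right342_of_t37_pairM_ofR_closed θ Mstar hG 𝔏 hparS hGp b hlev hβ1 hnbr 𝔬 rd H hp t37 hblkS hblkYS hGpS hDS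
  set B₀ : ℝ := (max 1 (N : ℝ) * ((mN : ℝ) * p.C (exp261 (@geo9Y θ.d₆ θ.ℓ₆ θ.hd' θ.hL' θ.b₀ θ.b₁ Mstar) p.δ₀ p.α) * Real.exp (2 * ((1 - 2 * p.α) * p.δ₀)))) with hB₀def
  have hB₀ : 0 ≤ B₀ := by have := p.C_nonneg hp (exp261 (@geo9Y θ.d₆ θ.ℓ₆ θ.hd' θ.hL' θ.b₀ θ.b₁ Mstar) p.δ₀ p.α); rw [hB₀def]; positivity
  set ML : ℝ := walkCntM₀Y θ.d₆ θ.ℓ₆ θ.hd' θ.hL' θ.b₀ θ.b₁ Mstar with hMLdef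
  have hN₁0 : 0 ≤ nearBlkCntY θ.d₆ θ.ℓ₆ θ.hd' θ.hL' θ.b₀ θ.b₁ Mstar := nearBlkCntY_nonneg
  set B₁' : ℝ := cR39 (basis39 (Matrix (Fin N) (Fin N) ℂ)) * Fintype.card (κ39 (Matrix (Fin N) (Fin N) ℂ)) * B₁ * Real.exp (2 * δ₁) with hB₁'
  have hB₁'0 : 0 ≤ B₁' := by
    rw [hB₁']; exact mul_nonneg (mul_nonneg (mul_nonneg (B9Thm39ReadingCoords.cR39_nonneg _) (Nat.cast_nonneg _)) hB) (Real.exp_nonneg _)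
  set C : ℝ := B₀ * B₁' * B₀ * Cg with hC
  have hC0 : 0 ≤ C := by rw [hC]; positivity
  have hcb' : 0 ≤ B9Thm39ReadingCoords.coordBound39 b := norm_nonneg _
  have hbb' : 0 ≤ B9Thm39ReadingCoords.basisBound39 b := Finset.sum_nonneg fun _ _ => norm_nonneg _
  refine ⟨max (max M₂ M₁) (max M₃ ML), min a₀ (a₁ / c35),
    lt_of_lt_of_le hM₂ ((le_max_left _ _).trans (le_max_left _ _)), lt_min ha₀ (div_pos ha₁ hc), fun x hM α₀ hα₀ hMa U hU => ?_⟩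
  have hM2 : M₂ ≤ (geo9Y x).M := ((le_max_left _ _).trans (le_max_left _ _)).trans hM
  have hM1 : M₁ ≤ (geo9Y x).M := ((le_max_right _ _).trans (le_max_left _ _)).trans hM
  have hM3 : M₃ ≤ (geo9Y x).M := ((le_max_left _ _).trans (le_max_right _ _)).trans hM
  have hML : ML ≤ (geo9Y x).M := ((le_max_right _ _).trans (le_max_right _ _)).trans hM
  obtain ⟨hL, hR⟩ := h342 x hM2 α₀ hα₀ (hMa.trans (min_le_left _ _)) U hU
  have hBk := blk348_of_display348_rateR θ Mstar 𝔏 bI hlev hβ1 hc hB hδ h348 x hM1 α₀ hα₀ (hMa.trans (min_le_right _ _)) U hU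
  have hM3' : M₃ ≤ ((θ.ℓ₆ : ℝ) + 1) * x.Mh := (geo9Y_M_eq x) ▸ hM3
  have hP := hthr x.toKIdx hM3' (𝔏 x).parS (𝔏 x).Gp U B₀ B₁' hB₀ hB₁'0 hL hR hBk
  exact proj349Maj_mono_const x
    (proj349Maj_of_allBlocks (G := specialUnitaryUnits (Fin N)) x b hcb (𝔏 x).parS (𝔏 x).Gp U (hbI0 x) (hlev x) (hβ1 x) hN₁0 (card_nearBlocks_le x hML) hC0 hθ₉ hP 1 (H x))
    hCPge

end Summit.QuantumFields.YangMills.BalabanUVNodes.N06Proj349AtPinsPhysRC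

end
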